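import Mathlib
import HarnessLib
import HarnessLib.Audit
import Summits.Schanuel.Statement
import Literature.Barriers.Schanuel.NesterenkoModularScopeSeries

/-!
Route: KFunctionRigidity

CLOSED (retired) 2026-08-15T13:51:13Z by operator:999:1257524 — reason: not-a-thesis: assembly does not conclude the sub-problem Statement — note: D-0027 §2.1 audit (human 2026-08-15: routes that do not decide the summit are removed): the assembly concludes `DifferentialKReach`, not the sub-problem statement; a NEW conforming route may be opened from the same idea (generated `closes : … → _root_.Schanuel`).. The file is kept as the record of this route; refuted decls are indexed as negative knowledge (`ledger negatives`).

# Route KFunctionRigidity — Scope route: integral slow-growth D-algebraic series are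
quasimodular-algebraic (K-function rigidity), so the differential K-method reaches only Nesterenko's
field

SCOPE ROUTE (barrier-to-theorem; card Schanuel/Schanuel/k-function-rigidity-modularity). It does NOT
assemble to `Schanuel`:
its Target is a certified-reach theorem for the technique class
`Literature.Barriers.Schanuel.NesterenkoModularScope`
(Philippon's differential K-functions, the only engine that ever gave trdeg ≥ 3 at one point), and
neither Target → Schanuel
nor Schanuel → Target is claimed; the Assembly ends at the route-local Target (PARTIAL/SCOPE route,
as the header says).
X (it suffices to show, for the scope question): DifferentialKReach — for every integer sequence a
of polynomial growth whose
series f = Σ aₙ zⁿ is differentially algebraic over ℚ(z), and every nome 0 < |q₀| < 1, the value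
f(q₀) is algebraic over
Nesterenko's field ℚ(q₀, P(q₀), Q(q₀), R(q₀)). X = RK' ∧ (specialisation): RK' = RigidityQM
(integral + slow growth +
D-algebraic ⇒ algebraic over ℚ(z, P, Q, R) as formal series) is the conjecture; the specialisation
step is a theorem modulo
the tree's named fact `nesterenko1996_thm_1_1`. Payoff for the summit is NEGATIVE KNOWLEDGE: every
number a one-nome
differential-K-function argument can certify lives in ℚ(q₀,P,Q,R)^alg (trdeg 3 or 4), so the class
proves an instance of
Schanuel (e.g. e ⊥ π = `ExpOnePiAlgebraicIndependent`) only at a nome where that field already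
contains the tuple; or else
¬RK' (support item NotRigidityQM) hands the class its first non-quasimodular input.
Lean: `∀ a : ℕ → ℤ, (∃ C : ℕ, ∀ n : ℕ, |a n| ≤ ((n : ℤ) + 2) ^ C) → (∃ k : ℕ, ¬ AlgebraicIndependent
ℚ (Fin.cons (PowerSeries.X : PowerSeries ℚ) (fun i : Fin (k + 1) => (⇑(PowerSeries.derivative
ℚ))^[(i : ℕ)] (PowerSeries.mk fun n => (a n : ℚ))))) → ∀ q : ℂ, 0 < ‖q‖ → ‖q‖ < 1 → IsAlgebraic
↥(IntermediateField.adjoin ℚ ({q, Literature.Barriers.Schanuel.ramanujanP q,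
Literature.Barriers.Schanuel.ramanujanQ q, Literature.Barriers.Schanuel.ramanujanR q} : Set ℂ)) (∑'
n : ℕ, (a n : ℂ) * q ^ n)`

## Assembly
Pure logic (checked in Sketch.lean: `fun h11 hR hS a hg hD q h0 h1 => hS h11 a hg (hR a hg hD) q h0
h1`): Nesterenko's
Theorem 1.1 (tree named fact) feeds SpecialisationAtNome; RigidityQM turns the D-algebraic
hypothesis of the Target into
algebraic dependence of (z,P,Q,R,f); the specialisation gives the Target. The assembly ends at the
route-local Target
DifferentialKReach, NOT at `Schanuel` (scope route; see Thesis and Kill criteria).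

Rationale: WHY THIS LINE. Nesterenko's proof (NesterenkoPhilippon2001 Ch. 3 §§3–5) uses of (z, P, Q, R) only
(K1) integer Taylor coefficients of
polynomial growth, (K2) an algebraic differential system over ℚ(z), (K3) functional algebraic
independence, plus a
multiplicity estimate — Philippon's K-functions (Crelle 497 (1998)); every specimen in 110 years is
a quasimodular form in a
cusp uniformiser, and the catalogue records only the empirical consequence (π, e^{π√d}, Γ at CM
points; never e with π).
Two rigidity principles foreign to the transcendence cone already do most of the work: Pólya–Carlson
(Carlson1921,
doi:10.1007/BF01378331; used as a non-holonomicity criterion in arXiv:math/0501379 p. 10) forces a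
non-rational K-function to
have |z| = 1 as NATURAL BOUNDARY, so it is never D-finite (K ∩ Siegel's E/G-world = ℚ(z)) and its
equation is genuinely
non-linear of Chazy/Halphen type; and integrality of cusp expansions is expected to force
arithmeticity of the uniformising
group (unbounded denominators, arXiv:2109.09040 Thm 1.1, for SL₂(ℤ)-commensurable groups;
Wolfart/DGMS arXiv:1307.4372 for
triangle groups), after which everything is algebraic over the level-one quasimodular field
ℚ(z,P,Q,R) (no level N survives:
ℚ(z,P(z^N),Q(z^N),R(z^N))^alg = ℚ(z,P,Q,R)^alg). Imported areas: gap/natural-boundary theory of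
integer power series
(complex analysis), differential algebra of D-algebraic series (doi:10.2307/2374602,
doi:10.1515/crll.2003.008), arithmetic
of noncongruence/non-arithmetic automorphic forms. What no prior route or the (empty) negatives
index does: attack the INPUT
CLASS of the one working engine instead of its output, with two rungs (DiffTrdegAtMostFour,
LowOrderRigidity) typable over
Mathlib alone and a specialisation lemma that turns Theorem 1.1 into a reach certificate.

RANKED CRUXES. #0 DifferentialKReach (target) — for every a : ℕ → ℤ of polynomial growth with Σ aₙ
zⁿ D-algebraic over ℚ(z) and every 0 < |q₀| < 1, Σ aₙ q₀ⁿ is algebraic over ℚ(q₀, P(q₀), Q(q₀),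
R(q₀)) (certified reach of the differential K-function class; card item C3). (why it might fail:
fails iff some integral slow-growth D-algebraic series takes at some nome a value transcendental
over ℚ(q₀,P,Q,R) — any NotRigidityQM witness run through Philippon's K-function engine would do it;
implied by RigidityQM + Thm 1.1.) [NesterenkoPhilippon2001, Philippon1998KFonctions,
Nesterenko1996SbMath]
#2 RigidityQM (crux) — RK' (card RK restricted to DIFFERENTIAL K-functions, triage fix 1, and with
the level-free conclusion, fix 3): if a : ℕ → ℤ has polynomial growth and f = Σ aₙ zⁿ ∈ ℚ⟦z⟧ is
differentially algebraic over ℚ(z) (z, f, f′, …, f^{(k)} algebraically dependent over ℚ for some k),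
then f is algebraic over ℚ(z, P, Q, R) — stated as algebraic dependence of (z, P, Q, R, f),
equivalent by Mahler's independence (tree: Mahler1969_ramanujan_algIndep_holds). [difficulty:
open-problem] (why it might fail: needs 'natural-boundary D-algebraic integral series are
automorphic' (no theorem beyond order-3 Chazy/Halphen classes) and 'integral cusp expansion ⇒
arithmetic group' (open for non-arithmetic cusped Fuchsian groups); one D-algebraic Lambert,
false-theta or class-number series kills it.) [NesterenkoPhilippon2001, doi:10.2307/2374602,
doi:10.1007/BF01378331, arXiv:2109.09040, arXiv:1307.4372, arXiv:1607.04168, Mahler1969]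
#3 DiffTrdegAtMostFour (crux) — rung of RK' typable over Mathlib alone: for a of polynomial growth
with f = Σ aₙ zⁿ D-algebraic over ℚ(z), the field ℚ(z, f, f′, f″, …) has transcendence degree ≤ 4
over ℚ (= that of the Ramanujan field; RK' ⇒ this because ℚ(z,P,Q,R)^alg is a differential field of
trdeg 4, Ramanujan's system being proved in tree). [deps: RigidityQM] [difficulty: XL] (why it might
fail: an integral slow-growth D-algebraic series whose differential field has trdeg ≥ 5 over ℚ
refutes it — e.g. integral generators of Zudilin's trdeg-7 Yukawa differential field (he asks for
them), if any had polynomial growth; no structural reason known short of RK'.) [arXiv:math/0008237,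
doi:10.1515/crll.2003.008, Mahler1969, NesterenkoPhilippon2001]
#4 LowOrderRigidity (crux) — rung of RK' typable over Mathlib alone: an integral polynomial-growth
series satisfying an algebraic differential equation of ORDER ≤ 2 over ℚ(z) is a rational function
(RK' ⇒ this via Bertrand–Zudilin: nothing in ℚ(z,P,Q,R)^alg off ℚ(z)^alg satisfies an ADE of order <
3, and Fatou/Carlson: algebraic + integral + radius 1 ⇒ rational). [difficulty: L] (why it might
fail: order 1 should follow from Painlevé 1888 (movable singularities of first-order ADEs are
algebraic) + Carlson 1921, but order 2 admits movable essential singularities (Painlevé–Gambier);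
one order-2 ADE over ℚ(z) with an integral natural-boundary solution refutes it.)
[doi:10.1007/BF01378331, arXiv:math/0501379, doi:10.1515/crll.2003.008, arXiv:1607.04168]
#9 SpecialisationAtNome (support) — Theorem 1.1 ⇒ specialisation: if (z, P, Q, R, f) are
algebraically dependent over ℚ for an integral slow-growth f, then for every 0 < |q₀| < 1 the value
f(q₀) is algebraic over ℚ(q₀,P(q₀),Q(q₀),R(q₀)). Proof sketch: A = ℚ[z,P,Q,R] is a polynomial ring
by Mahler (tree fact proved); take a primitive irreducible Φ ∈ A[Y] with Φ(f) = 0; evaluation at q₀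
is a ring hom on A[f] (absolutely convergent Cauchy products, tree `hasSum_ramanujanComposite`); its
kernel on A is a prime of height ≤ 1 because trdeg ≥ 3 (Thm 1.1), hence 0 or principal, so not all
coefficients of Φ die. [difficulty: M] [NesterenkoPhilippon2001, Mahler1969, Nesterenko1996SbMath]
#9 RadiusOne (support) — leg (A), first sentence: an integer series of polynomial growth that is not
a polynomial converges absolutely on the open unit disc and diverges outside it (radius exactly 1 —
the hypothesis under which Pólya–Carlson bites). [difficulty: provable-now] [doi:10.1007/BF01378331,
PolyaSzego1925]
#9 NotRigidityQM (support) — negative side of RK' (the card's ENGINE branch): exhibit an integral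
polynomial-growth D-algebraic series NOT algebraic over ℚ(z,P,Q,R) — candidates to test first in the
literature: Σ d(n)zⁿ and Σ σ₂ₖ(n)zⁿ (Lambert), 12·Σ H(n)zⁿ (Hurwitz class numbers, weight-3/2 mock),
false theta Σ(−1)ⁿ z^{n(n+1)/2}, Σ z^{n³} (Rubel's question), integral rescaled cusp expansions of
holomorphic forms for non-arithmetic Hecke groups (DGMS). A witness is verbatim a new input to
Philippon's K-function theorem. [difficulty: open-problem] [arXiv:math/0008237, arXiv:1307.4372,
doi:10.2307/2374602, NesterenkoPhilippon2001]

TWO-LAYER PLAN. Foreseen glued splits (nothing filed now): RigidityQM ⇐ AutomorphyFromADE (a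
non-rational integral slow-growth D-algebraic
series is the cusp expansion of a meromorphic quasimodular-type form for a cusped Fuchsian group of
finite covolume) →
IntegralCuspImpliesArithmetic (integral expansion ⇒ group commensurable with SL₂(ℤ); CDT + DGMS-type
input) → RigidityQM;
LowOrderRigidity ⇐ FirstOrderRational (Painlevé + Carlson, with both facts as hypotheses) →
SecondOrderRational →
LowOrderRigidity; DifferentialKReach at CM nomes ⇐ SpecialisationAtNome +
`ramanujan_values_exp_neg_two_pi` (values in
ℚ(π, e^π, Γ(1/4))^alg at q₀ = e^{−2π}).

KILL CRITERIA. (i) A NotRigidityQM witness in print or by proof (an integral polynomial-growth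
D-algebraic series outside ℚ(z,P,Q,R)^alg)
refutes RigidityQM: close `refuted:RigidityQM` and hand the witness to the modular-engine cards
(two-moduli-nesterenko,
e-pi-obstruction-tate-gevrey, cusp-budget-lemma) as a new K-system — the card's engine branch
becomes their route, not this one.
(ii) LowOrderRigidity refuted (order-2 integral natural-boundary solution) also refutes RigidityQM
(via Bertrand–Zudilin):
same close. (iii) DiffTrdegAtMostFour refuted: same. (iv) If refuters rule that a scope route whose
Target is not a
consequence of `Schanuel` is outside D-0016, close `superseded` in favour of the triage-6 merged
barrier entry and lift the
typed decls (RigidityQM, SpecialisationAtNome, DifferentialKReach) into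
`Literature/Barriers/Schanuel/NesterenkoModularScope*`.
Nothing proved elsewhere moots it except a proof of `ExpOnePiAlgebraicIndependent` by a one-nome
K-function argument, which
would itself refute DifferentialKReach or exhibit e ∈ ℚ(q₀,P,Q,R)^alg.

NOT DECOMPOSED YET. The automorphy statement (C) of the card and the integrality ⇒ arithmeticity
step (B) — both need Fuchsian-group /
noncongruence q-expansion infrastructure Mathlib lacks and are layer-2 children of RigidityQM; the
e^{o(n)}-growth variant
(radius ≥ 1 instead of polynomial growth: covers J(q)-type Mahler-method inputs and puts mock theta
functions on trial);
K-SYSTEMS (vectors, condition (K3)) rather than single series — RK' for each component suffices for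
the reach certificate;
Philippon's engine theorem for a hypothetical non-quasimodular K-system (multiplicity estimate for
its D-stable ideals,
NesterenkoPhilippon2001 Ch. 10) — opened only if NotRigidityQM gets a witness; the D-finite case
(integral + radius 1 +
holonomic ⇒ rational: Pólya–Carlson + finitely many singularities, arXiv:math/0501379 p. 10) is
KNOWN and left as a cite fact.

CHEAPEST FALSIFIER. Literature lookups, in this order: (1) is any of Σ d(n)zⁿ, Σ σ₂(n)zⁿ, Σ_p z^p, Σ
μ(n)zⁿ, 12ΣH(n)zⁿ, false thetas, Σ z^{n³}
KNOWN to be differentially algebraic over ℂ(z)? (Lipshitz–Rubel doi:10.2307/2374602 gap theorem and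
Rubel's problem lists
for the lacunary ones; hypertranscendence literature for Lambert series) — one 'yes' kills
RigidityQM; (2) does any
holomorphic automorphic form for a non-arithmetic Hecke triangle group have an integral rescaled
cusp expansion (Wolfart,
Akiyama, DGMS arXiv:1307.4372 tables)? — 'yes' kills RigidityQM; (3) kit: guess-and-prove search for
an ADE of order ≤ 3,
degree ≤ 4 among z^a f^{(j)} from 5000 exact coefficients of Σ d(n)zⁿ and 12ΣH(n)zⁿ (absence =
evidence only). I could not
run (1)–(2) to the end this session: galaxy/arXiv/OpenAlex were saturated or rate-limited
(NOTES.md); zbMATH found no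
D-algebraicity result for these series.

NUMBERS. trdeg_ℚ ℚ(z,P,Q,R) = 4 (Mahler 1969; tree `Mahler1969_ramanujan_algIndep_holds`); trdeg
ℚ(q₀,P,Q,R) ≥ 3 for 0<|q₀|<1
(Nesterenko 1996 Thm 1.1, named fact), = 3 at CM nomes (R(e^{−2π}) = 0), conjecturally 4 otherwise
(Conj. 1.11 refines);
minimal order of an ADE for a non-constant modular form = 3 (Bertrand–Zudilin
doi:10.1515/crll.2003.008, n = 1);
Nesterenko's multiplicity constant c = 10⁴⁷ (Ch. 3 Thm 2.3); Zudilin's Yukawa differential field: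
trdeg 7 over ℂ(q)
(arXiv:math/0008237 Thm 4). Items at open: 8 (1 target, 3 cruxes, 3 support, 1 assembly).

DEFINITION REQUESTS. None blocking: everything is stated over Mathlib's `PowerSeries`,
`PowerSeries.derivative`, `AlgebraicIndependent`,
`Algebra.trdeg` and the tree's formal Ramanujan series
(`Literature.Barriers.Schanuel.ramanujanPSeries` etc.). Cite facts
wanted (for the D-finite support statement and the order-1 half of LowOrderRigidity, to be filed as
`--kind cite`):
Pólya–Carlson (Carlson1921: integer coefficients, convergent in the unit disc ⇒ rational or |z| = 1
natural boundary);
Painlevé 1888 (movable singularities of first-order ADEs are algebraic); Lipshitz–Rubel 1986 gap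
theorem.

Novelty: Searches (2026-08-15): `lit search --source zbmath` × 8 ("differentially algebraic power series gap
theorem" → LipshitzRubel1986
doi:10.2307/2374602 + 1991 report; "differentially algebraic power series integer coefficients" → 4,
incl. arXiv:1607.04168;
"Polya-Carlson theorem differentially algebraic" → 0; "hypertranscendence quasimodular forms" → 0;
"differential transcendence
Lambert series divisor function" → 0; "natural boundary algebraic differential equation third order
Chazy" → 1 (proc. volume);
DGMS → arXiv:1307.4372; CDT → arXiv:2109.09040 + Bourbaki doi:10.24033/ast.1206); `lit search
--source crossref` (gap theorem →
Denef–Lipshitz 1984 doi:10.1007/bf01579200, Sibuya–Sperber 1980); `lit read` arXiv:1905.06450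
(BNZ2020 Thm 1.1–1.6: D-FINITE +
height o(log n) ⇒ rational; nothing D-algebraic), arXiv:1607.04168 pp. 4–8, 20, 22 (GJMP2016:
D-algebraic integer series,
theta is DA with Hadamard-type gaps, Chazy III natural boundaries, question 'do DA integer series
reduce mod p to algebraic
functions'), arXiv:math/0501379 p. 10 (Pólya–Carlson as non-holonomicity criterion); `lit galaxy
search --star all/pdf` × 3
(1 irrelevant hit; 2 runs saturated, rc 3); `lit frontier/bridges` not reachable this session
(daemon saturation logged in
NOTES.md); OpenAlex/S2/arXiv APIs rate-limited (429). In-tree: barrier NesterenkoModularScope + 60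
sibling files read for decls
(formal P,Q,R, Ramanujan system PROVED, Mahler PROVED, Thm 1.1 / Thm 2.3 named).
Nearest prior art found: Philippon  [refs: 10.2307/2374602, 10.24033/ast.1206, 10.1007/bf01579200, 10.1007/BF01378331, 10.1515/crll.2003.008, 1607.04168, 1307.4372, 2109.09040, 1905.06450, math/0501379, doi:10.2307/2374602, doi:10.24033/ast.1206, doi:10.1007/bf01579200, doi:10.1007/BF01378331, doi:10.1515/crll.2003.008, LipshitzRubel1986, NesterenkoPhilippon2001, Carlson1921, BertrandZudilin2003]

Barriers (technique_class: rigidity-classification polya-carlson k-functions automorphy): - technique_class: rigidity-classification polya-carlson k-functions automorphy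
- Literature.Barriers.Schanuel.NesterenkoModularScope: neither used nor evaded — the route PROVES
(RigidityQM ⇒ DifferentialKReach) or REFUTES (NotRigidityQM) the barrier's empirical scope clause
for the whole differential-K-function class; it must not be read as a route through the barrier, and
its Target is not a Schanuel instance.
- Literature.Barriers.Schanuel.EFunctionValuesAtAlgebraicPoints: respected and sharpened —
Pólya–Carlson makes non-rational K-functions non-holonomic, so the E/G-function class and the
K-function class meet only in ℚ(z); no item mixes the two arithmetics.
- Literature.Barriers.Schanuel.LargeTranscendenceDegree: other technique class
(Gelfond–Chudnovsky–Philippon criteria on exponential grids); untouched — no grid, no logarithms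
here.
- Literature.Barriers.Schanuel.AlgebraicIndependenceOfLogarithms: n/a (no logarithms of algebraic
numbers occur; values live at nomes).
- Literature.Barriers.Schanuel.LinearSubgroupMethodLimit: n/a (no algebraic-subgroup /
auxiliary-function-on-group-variety argument is proposed).
- Literature.Barriers.Schanuel.PeriodConjectureOverQbarScope: consistent — DifferentialKReach says
K-outputs are algebraic over ℚ(q₀,P,Q,R), i.e. over 2πi-normalised periods and quasi-periods of one
elliptic curve plus the nome, inside the sectors the period conjecture over ℚ̄ already governs; e
enters only as a nome.
- Literature.Barriers.Schanuel.AxSchanuelFun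

Novelty grade: new-combination — ROUTE REVIEW (refuter rreview cdf7e025, 2026-08-15). VERDICT: keep open with two repairs; new-combination confirmed on my reading (RK' itself found stated nowhere; legs Pólya–Carlson / CDT–DGMS / Chazy–Halphen / Bertrand–Zudilin published; searchd down, zbMATH 'ADE Lambert series' → Wakayama–Yamamot (refuter refuter-rreview-route-Schanuel-KFunction-cdf7e025-0, 2026-08-15T13:48:55Z; prior: NesterenkoPhilippon2001 Ch.3 §3 (K-function axioms; Philippon Crelle 497), Carlson1921 doi:10.1007/BF01378331, arXiv:2109.09040 (CDT), arXiv:1307.4372 (DGMS), doi:10.1515/crll.2003.008 (Bertrand–Zudilin), doi:10.2307/2374602 (Lipshitz–Rubel), Adamczewski–Dreyfus–Hardouin JAMS 2021, Mahler1969)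

History (route lifecycle, newest last):
- 2026-08-15T13:51:13Z · CLOSED retired — not-a-thesis: assembly does not conclude the sub-problem Statement (operator:999:1257524)

sub-problem: Schanuel · status: closed(retired) · opened planner-plancard-Schanuel-Schanuel-k-function-66bff341-0 2026-08-15T11:50:20Z · rev 0 · ledger route-Schanuel-KFunctionRigidity
GENERATED by the gate from the ledger (D-0016/17). Provers cite these decls: `theorem foo : Summit.Schanuel.Schanuel.Theses.KFunctionRigidity.<Decl> := …` in Summits/Schanuel/Schanuel/Theorems/<Name>.lean.
-/

namespace Summit.Schanuel.Schanuel.Theses.KFunctionRigidity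

open scoped BigOperators Topology Manifold Classical MeasureTheory ProbabilityTheory Matrix InnerProductSpace ComplexConjugate ContinuousMap
open Filter Set Function TopologicalSpace MeasureTheory

attribute [summit_statement] _root_.Schanuel

open Literature.Periods

/-- item stmt-Schanuel-6679 · target · rank 0 · closed · moot by None · by planner
why it might fail: fails iff some integral slow-growth D-algebraic series takes at some nome a value transcendental over ℚ(q₀,P,Q,R) — any NotRigidityQM witness run through Philippon's K-function engine would do it; implied by RigidityQM + Thm 1.1.
sources: NesterenkoPhilippon2001, Philippon1998KFonctions, Nesterenko1996SbMath
[target] for every a : ℕ → ℤ of polynomial growth with Σ aₙ zⁿ D-algebraic over ℚ(z) and every 0 <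
|q₀| < 1, Σ aₙ q₀ⁿ is algebraic over ℚ(q₀, P(q₀), Q(q₀), R(q₀)) (certified reach of the differential
K-function class; card item C3). -/
@[route_item "route-Schanuel-KFunctionRigidity"]
def DifferentialKReach : Prop :=
  ∀ a : ℕ → ℤ, (∃ C : ℕ, ∀ n : ℕ, |a n| ≤ ((n : ℤ) + 2) ^ C) → (∃ k : ℕ, ¬ AlgebraicIndependent ℚ (Fin.cons (PowerSeries.X : PowerSeries ℚ) (fun i : Fin (k + 1) => (⇑(PowerSeries.derivative ℚ))^[(i : ℕ)] (PowerSeries.mk fun n => (a n : ℚ))))) → ∀ q : ℂ, 0 < ‖q‖ → ‖q‖ < 1 → IsAlgebraic ↥(IntermediateField.adjoin ℚ ({q, Literature.Barriers.Schanuel.ramanujanP q, Literature.Barriers.Schanuel.ramanujanQ q, Literature.Barriers.Schanuel.ramanujanR q} : Set ℂ)) (∑' n : ℕ, (a n : ℂ) * q ^ n)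

/-- item stmt-Schanuel-6680 · crux · rank 2 · closed · moot by None · by planner
why it might fail: needs 'natural-boundary D-algebraic integral series are automorphic' (no theorem beyond order-3 Chazy/Halphen classes) and 'integral cusp expansion ⇒ arithmetic group' (open for non-arithmetic cusped Fuchsian groups); one D-algebraic Lambert, false-theta or class-number series kills it.
sources: NesterenkoPhilippon2001, doi:10.2307/2374602, doi:10.1007/BF01378331, arXiv:2109.09040, arXiv:1307.4372, arXiv:1607.04168
[crux] RK' (card RK restricted to DIFFERENTIAL K-functions, triage fix 1, and with the level-free
conclusion, fix 3): if a : ℕ → ℤ has polynomial growth and f = Σ aₙ zⁿ ∈ ℚ⟦z⟧ is differentially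
algebraic over ℚ(z) (z, f, f′, …, f^{(k)} algebraically dependent over ℚ for some k), then f is
algebraic over ℚ(z, P, Q, R) — stated as algebraic dependence of (z, P, Q, R, f), equivalent by
Mahler's independence (tree: Mahler1969_ramanujan_algIndep_holds). [difficulty: open-problem] -/
@[route_item "route-Schanuel-KFunctionRigidity"]
def RigidityQM : Prop :=
  ∀ a : ℕ → ℤ, (∃ C : ℕ, ∀ n : ℕ, |a n| ≤ ((n : ℤ) + 2) ^ C) → (∃ k : ℕ, ¬ AlgebraicIndependent ℚ (Fin.cons (PowerSeries.X : PowerSeries ℚ) (fun i : Fin (k + 1) => (⇑(PowerSeries.derivative ℚ))^[(i : ℕ)] (PowerSeries.mk fun n => (a n : ℚ))))) → ¬ AlgebraicIndependent ℚ ![(PowerSeries.X : PowerSeries ℚ), PowerSeries.map (Int.castRingHom ℚ) Literature.Barriers.Schanuel.ramanujanPSeries, PowerSeries.map (Int.castRingHom ℚ) Literature.Barriers.Schanuel.ramanujanQSeries, PowerSeries.map (Int.castRingHom ℚ) Literature.Barriers.Schanuel.ramanujanRSeries, PowerSeries.mk fun n => (a n : ℚ)]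

/-- item stmt-Schanuel-6681 · crux · rank 3 · closed · moot by None · by planner
why it might fail: an integral slow-growth D-algebraic series whose differential field has trdeg ≥ 5 over ℚ refutes it — e.g. integral generators of Zudilin's trdeg-7 Yukawa differential field (he asks for them), if any had polynomial growth; no structural reason known short of RK'.
sources: arXiv:math/0008237, doi:10.1515/crll.2003.008, Mahler1969, NesterenkoPhilippon2001
[crux] rung of RK' typable over Mathlib alone: for a of polynomial growth with f = Σ aₙ zⁿ
D-algebraic over ℚ(z), the field ℚ(z, f, f′, f″, …) has transcendence degree ≤ 4 over ℚ (= that of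
the Ramanujan field; RK' ⇒ this because ℚ(z,P,Q,R)^alg is a differential field of trdeg 4,
Ramanujan's system being proved in tree). [deps: RigidityQM] [difficulty: XL] -/
@[route_item "route-Schanuel-KFunctionRigidity"]
def DiffTrdegAtMostFour : Prop :=
  ∀ a : ℕ → ℤ, (∃ C : ℕ, ∀ n : ℕ, |a n| ≤ ((n : ℤ) + 2) ^ C) → (∃ k : ℕ, ¬ AlgebraicIndependent ℚ (Fin.cons (PowerSeries.X : PowerSeries ℚ) (fun i : Fin (k + 1) => (⇑(PowerSeries.derivative ℚ))^[(i : ℕ)] (PowerSeries.mk fun n => (a n : ℚ))))) → Algebra.trdeg ℚ ↥(Algebra.adjoin ℚ (insert (PowerSeries.X : PowerSeries ℚ) (Set.range fun i : ℕ => (⇑(PowerSeries.derivative ℚ))^[i] (PowerSeries.mk fun n => (a n : ℚ))))) ≤ (4 : Cardinal)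

/-- item stmt-Schanuel-6682 · crux · rank 4 · closed · moot by None · by planner
why it might fail: order 1 should follow from Painlevé 1888 (movable singularities of first-order ADEs are algebraic) + Carlson 1921, but order 2 admits movable essential singularities (Painlevé–Gambier); one order-2 ADE over ℚ(z) with an integral natural-boundary solution refutes it.
sources: doi:10.1007/BF01378331, arXiv:math/0501379, doi:10.1515/crll.2003.008, arXiv:1607.04168
[crux] rung of RK' typable over Mathlib alone: an integral polynomial-growth series satisfying an
algebraic differential equation of ORDER ≤ 2 over ℚ(z) is a rational function (RK' ⇒ this via
Bertrand–Zudilin: nothing in ℚ(z,P,Q,R)^alg off ℚ(z)^alg satisfies an ADE of order < 3, and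
Fatou/Carlson: algebraic + integral + radius 1 ⇒ rational). [difficulty: L] -/
@[route_item "route-Schanuel-KFunctionRigidity"]
def LowOrderRigidity : Prop :=
  ∀ a : ℕ → ℤ, (∃ C : ℕ, ∀ n : ℕ, |a n| ≤ ((n : ℤ) + 2) ^ C) → ¬ AlgebraicIndependent ℚ ![(PowerSeries.X : PowerSeries ℚ), PowerSeries.mk (fun n => (a n : ℚ)), PowerSeries.derivative ℚ (PowerSeries.mk fun n => (a n : ℚ)), PowerSeries.derivative ℚ (PowerSeries.derivative ℚ (PowerSeries.mk fun n => (a n : ℚ)))] → ∃ p r : Polynomial ℚ, r ≠ 0 ∧ (r : PowerSeries ℚ) * (PowerSeries.mk fun n => (a n : ℚ)) = (p : PowerSeries ℚ)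

/-- item stmt-Schanuel-6683 · support · rank 9 · closed · moot by None · by planner
sources: NesterenkoPhilippon2001, Mahler1969, Nesterenko1996SbMath
[support] Theorem 1.1 ⇒ specialisation: if (z, P, Q, R, f) are algebraically dependent over ℚ for an
integral slow-growth f, then for every 0 < |q₀| < 1 the value f(q₀) is algebraic over
ℚ(q₀,P(q₀),Q(q₀),R(q₀)). Proof sketch: A = ℚ[z,P,Q,R] is a polynomial ring by Mahler (tree fact
proved); take a primitive irreducible Φ ∈ A[Y] with Φ(f) = 0; evaluation at q₀ is a ring hom on A[f]
(absolutely convergent Cauchy products, tree `hasSum_ramanujanComposite`); its kernel on A is a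
prime of height ≤ 1 because trdeg ≥ 3 (Thm 1.1), hence 0 or principal, so not all coefficients of Φ
die. [difficulty: M] -/
@[route_item "route-Schanuel-KFunctionRigidity"]
def SpecialisationAtNome : Prop :=
  Literature.Barriers.Schanuel.nesterenko1996_thm_1_1 → ∀ a : ℕ → ℤ, (∃ C : ℕ, ∀ n : ℕ, |a n| ≤ ((n : ℤ) + 2) ^ C) → ¬ AlgebraicIndependent ℚ ![(PowerSeries.X : PowerSeries ℚ), PowerSeries.map (Int.castRingHom ℚ) Literature.Barriers.Schanuel.ramanujanPSeries, PowerSeries.map (Int.castRingHom ℚ) Literature.Barriers.Schanuel.ramanujanQSeries, PowerSeries.map (Int.castRingHom ℚ) Literature.Barriers.Schanuel.ramanujanRSeries, PowerSeries.mk fun n => (a n : ℚ)] → ∀ q : ℂ, 0 < ‖q‖ → ‖q‖ < 1 → IsAlgebraic ↥(IntermediateField.adjoin ℚ ({q, Literature.Barriers.Schanuel.ramanujanP q, Literature.Barriers.Schanuel.ramanujanQ q, Literature.Barriers.Schanuel.ramanujanR q} : Set ℂ)) (∑' n : ℕ, (a n : ℂ) * q ^ n)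

/-- item stmt-Schanuel-6684 · support · rank 9 · closed · moot by None · by planner
sources: doi:10.1007/BF01378331, PolyaSzego1925
[support] leg (A), first sentence: an integer series of polynomial growth that is not a polynomial
converges absolutely on the open unit disc and diverges outside it (radius exactly 1 — the
hypothesis under which Pólya–Carlson bites). [difficulty: provable-now] -/
@[route_item "route-Schanuel-KFunctionRigidity"]
def RadiusOne : Prop :=
  ∀ a : ℕ → ℤ, (∃ C : ℕ, ∀ n : ℕ, |a n| ≤ ((n : ℤ) + 2) ^ C) → (∀ N : ℕ, ∃ n : ℕ, N ≤ n ∧ a n ≠ 0) → (∀ z : ℂ, ‖z‖ < 1 → Summable fun n : ℕ => (a n : ℂ) * z ^ n) ∧ (∀ z : ℂ, 1 < ‖z‖ → ¬ Summable fun n : ℕ => (a n : ℂ) * z ^ n)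

/-- item stmt-Schanuel-6685 · support · rank 9 · closed · moot by None · by planner
sources: arXiv:math/0008237, arXiv:1307.4372, doi:10.2307/2374602, NesterenkoPhilippon2001
[support] negative side of RK' (the card's ENGINE branch): exhibit an integral polynomial-growth
D-algebraic series NOT algebraic over ℚ(z,P,Q,R) — candidates to test first in the literature: Σ
d(n)zⁿ and Σ σ₂ₖ(n)zⁿ (Lambert), 12·Σ H(n)zⁿ (Hurwitz class numbers, weight-3/2 mock), false theta
Σ(−1)ⁿ z^{n(n+1)/2}, Σ z^{n³} (Rubel's question), integral rescaled cusp expansions of holomorphic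
forms for non-arithmetic Hecke groups (DGMS). A witness is verbatim a new input to Philippon's
K-function theorem. [difficulty: open-problem] -/
@[route_item "route-Schanuel-KFunctionRigidity"]
def NotRigidityQM : Prop :=
  ¬ RigidityQM

/-- item stmt-Schanuel-6686 · assembly · rank 1 · closed · moot by None · by planner
sources: NesterenkoPhilippon2001
[assembly] nesterenko1996_thm_1_1 → RigidityQM → SpecialisationAtNome → DifferentialKReach. -/
@[route_item "route-Schanuel-KFunctionRigidity"]
def Assembly : Prop :=
  Literature.Barriers.Schanuel.nesterenko1996_thm_1_1 → RigidityQM → SpecialisationAtNome → DifferentialKReach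

end Summit.Schanuel.Schanuel.Theses.KFunctionRigidity
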